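import Mathlib
import Summits.KontsevichZagierPeriods.KontsevichZagierPeriods.Theorems.SoloInformedKZSaturation
import Summits.KontsevichZagierPeriods.KontsevichZagierPeriods.Theorems.SoloInformedGermAlgebra
import HarnessLib
import HarnessLib.Audit

/-!
# SoloInformed — complex symbols: Ayoub's localised injectivity typed faithfully

`SoloInformedAyoubKZLoc` (`Theorems/SoloInformedKZSaturation.lean`) is the KZ-side READING of
injectivity of Ayoub's evaluation `Ev : 𝒫 = 𝒫^eff[θ⁻¹] → ℂ` [Ayoub 2014, Def. 10, Rem. 13]: its
statement already contains the push-forward to the formal period ring. This file types the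
hypothesis ITSELF, on Ayoub's side, and kernel-checks the push-forward.

* `soloInformedGenProd a b` — the **product generator** `a ⊠ b` in disjoint variables,
  `(a ⊠ b)(z, w) = a(z) b(w)`, a generator of dimension `n + m` (analytic on the polydisc of radius
  `min ρ_a ρ_b`, real on real points, algebraic over `ℚ(z, w)` by the function-algebra bridge of
  `Theorems/SoloInformedGermAlgebra.lean` and a coordinate pull-back lemma,
  `soloInformed_algFns_comp_proj`). This is the ring structure of `𝒫^eff` [Ayoub 2014, §2.2].
* Complex symbols are PAIRS `(u, v)` ("`u + i v`") of real symbols; a complex one-variable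
  generator `θ = g + i h` (`g h : SoloInformedAyoubGen 1`) acts by
  `soloInformedMulTheta g h (u, v) = (u ⊠ g − v ⊠ h, u ⊠ h + v ⊠ g)`.
* `SoloInformedAyoubEvInjLoc` — **Ayoub's conjecture in the shape of [Ayoub 2014, Rem. 13],
  localised at a complex generator `θ` with `Ev θ = 2πi`, restricted to real symbols**: a real
  symbol `x` with `Ev x = 0` satisfies `θ^N · (k x) ∈ Rel ⊗ ℤ[i]` for some `N` and `k ≠ 0`, i.e.
  `x ↦ 0` in `(Symbols ⧸ Rel) ⊗ ℤ[i] [θ⁻¹] ⊗ ℚ`.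
* (the `θ`-clause is satisfiable — `θ = i·8/((t−1)²+1)` has `Ev θ = 2πi` — see
  `Theorems/SoloInformedAyoubTheta.lean`, `soloInformed_ayoubTheta_exists`.)
* `soloInformed_ayoubKZLoc_of_evInjLoc : SoloInformedAyoubEvInjLoc → SoloInformedAyoubKZLoc` —
  the push-forward: `Ψ` is multiplicative on product generators modulo the KZ moves
  (`soloInformed_toFormalPeriod_psi_genProd`, from `KZ.of_mul_of`, the product-integrand formula
  and integrand congruence), hence `Ψ ⊗ ℤ[i]` maps `θ^N (k x)` to
  `k Ψ(x) · (A_N + i B_N)` with `A_N + i B_N ↦ (2πi)^N ≠ 0` under `evalP ⊗ ℂ`; so one of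
  `A_N, B_N` has non-zero period and kills `Ψ x` (torsion-freeness of `P`, FACT M).
* `soloInformed_ayoubTransferInj₈` — the transfer chain with this hypothesis:
  `SeparationOfPoles → NashCubulation → AyoubEvInjLoc → KZSat → KontsevichZagierPeriods`.

What remains paper-level (see `paper/kz-saturation.md`): (0) Ayoub's Prop. 11 / HMS Prop. 13.2.6
(`GPC ∀ Nori motives ⟹ Ev` injective on `𝒫`), and (α) that Ayoub's product on `𝒫^eff` is the
disjoint-variable product `⊠` used here.

References: J. Ayoub, *Periods and the conjectures of Grothendieck and Kontsevich–Zagier*, EMS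
Newsl. 91 (2014) 12–18, §2.2, Def. 6, Def. 9–10, Prop. 11, Rem. 12–13; A. Huber,
S. Müller-Stach, *Periods and Nori motives* (Springer, 2017), Prop. 13.2.6; M. Kontsevich,
D. Zagier, *Periods* (2001), §1.2, §4.1.
-/

noncomputable section

open scoped BigOperators
open Set MeasureTheory
open Literature.NumberTheory.Transcendental Literature.NumberTheory.Transcendental.KZ

namespace Summit.KontsevichZagierPeriods.KontsevichZagierPeriods.Theorems

/-! ### Coordinate pull-back of the algebraicity encoding -/

/-- Index map for pulling back an algebraicity witness along a coordinate selection `e`: the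
variable `zᵢ` goes to `z_{e i}`, the extra (value) variable to the extra variable. -/
def soloInformedSnocIdx {n k : ℕ} (e : Fin n → Fin k) : Fin (n + 1) → Fin (k + 1) :=
  Fin.snoc (fun i => Fin.castSucc (e i)) (Fin.last k)

/-- `snocIdx e` on an old variable. -/
@[simp] theorem soloInformedSnocIdx_castSucc {n k : ℕ} (e : Fin n → Fin k) (i : Fin n) :
    soloInformedSnocIdx e (Fin.castSucc i) = Fin.castSucc (e i) := by
  simp [soloInformedSnocIdx]

/-- `snocIdx e` on the value variable. -/
@[simp] theorem soloInformedSnocIdx_last {n k : ℕ} (e : Fin n → Fin k) :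
    soloInformedSnocIdx e (Fin.last n) = Fin.last k := by
  simp [soloInformedSnocIdx]

/-- `snoc z t ∘ snocIdx e = snoc (z ∘ e) t`. [folklore] -/
theorem soloInformed_snoc_comp_snocIdx {n k : ℕ} (e : Fin n → Fin k) {α : Type*}
    (z : Fin k → α) (t : α) :
    (Fin.snoc z t : Fin (k + 1) → α) ∘ soloInformedSnocIdx e = Fin.snoc (fun i => z (e i)) t := by
  funext j
  rcases Fin.eq_castSucc_or_eq_last j with ⟨i, rfl⟩ | rfl
  · simp
  · simp

/-- `snocIdx e` is injective when `e` is. [folklore] -/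
theorem soloInformedSnocIdx_injective {n k : ℕ} {e : Fin n → Fin k}
    (he : Function.Injective e) : Function.Injective (soloInformedSnocIdx e) := by
  intro a b hab
  rcases Fin.eq_castSucc_or_eq_last a with ⟨i, rfl⟩ | rfl <;>
    rcases Fin.eq_castSucc_or_eq_last b with ⟨j, rfl⟩ | rfl
  · rw [soloInformedSnocIdx_castSucc, soloInformedSnocIdx_castSucc, Fin.castSucc_inj] at hab
    rw [he hab]
  · rw [soloInformedSnocIdx_castSucc, soloInformedSnocIdx_last] at hab
    exact absurd hab (Fin.castSucc_lt_last _).ne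
  · rw [soloInformedSnocIdx_last, soloInformedSnocIdx_castSucc] at hab
    exact absurd hab (Fin.castSucc_lt_last _).ne'
  · rfl

/-- **Coordinate pull-back**: if `g` is algebraic over `ℚ(z₁,…,zₙ)` on `U`, then
`z ↦ g (z ∘ e)` is algebraic over `ℚ(z₁,…,z_k)` on the pre-image of `U`, for an injective
coordinate selection `e`. [Lang, Algebra, V §1] -/
theorem soloInformed_algFns_comp_proj {n k : ℕ} {e : Fin n → Fin k} (he : Function.Injective e)
    {U : Set (Fin n → ℂ)} {g : (Fin n → ℂ) → ℂ} (hg : g ∈ soloInformedAlgFns U) :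
    (fun z : Fin k → ℂ => g (fun i => z (e i))) ∈
      soloInformedAlgFns {z : Fin k → ℂ | (fun i => z (e i)) ∈ U} := by
  obtain ⟨P, hP0, hP⟩ := hg
  refine ⟨MvPolynomial.rename (soloInformedSnocIdx e) P, fun h => hP0 ?_, fun z hz => ?_⟩
  · exact MvPolynomial.rename_injective _ (soloInformedSnocIdx_injective he) (by rw [h, map_zero])
  · rw [MvPolynomial.aeval_rename, soloInformed_snoc_comp_snocIdx]
    exact hP _ hz

/-- A coordinate selection does not increase the sup norm. [folklore] -/
theorem soloInformed_norm_proj_le {n k : ℕ} (e : Fin n → Fin k) (z : Fin k → ℂ) :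
    ‖(fun i => z (e i))‖ ≤ ‖z‖ :=
  (pi_norm_le_iff_of_nonneg (norm_nonneg z)).2 fun i => norm_le_pi_norm z (e i)

/-- A coordinate selection maps the polydisc of radius `r` into the polydisc of radius `s ≥ r`. -/
theorem soloInformed_proj_mem_ball {n k : ℕ} (e : Fin n → Fin k) {z : Fin k → ℂ} {r s : ℝ}
    (hz : z ∈ Metric.ball (0 : Fin k → ℂ) r) (hrs : r ≤ s) :
    (fun i => z (e i)) ∈ Metric.ball (0 : Fin n → ℂ) s := by
  rw [mem_ball_zero_iff] at hz ⊢
  exact (soloInformed_norm_proj_le e z).trans_lt (hz.trans_le hrs)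

/-- Complexification commutes with coordinate selections. -/
theorem soloInformedToC_proj {n k : ℕ} (e : Fin n → Fin k) (x : Fin k → ℝ) :
    (fun i => soloInformedToC k x (e i)) = soloInformedToC n (fun i => x (e i)) := by
  funext i; simp

/-- Coordinate selections are entire. [folklore] -/
theorem soloInformed_analyticOnNhd_proj {n k : ℕ} (e : Fin n → Fin k) :
    AnalyticOnNhd ℂ (fun z : Fin k → ℂ => fun i => z (e i)) univ := fun z _ =>
  analyticAt_pi_iff.mpr fun i =>
    (ContinuousLinearMap.proj (R := ℂ) (φ := fun _ : Fin k => ℂ) (e i)).analyticAt z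

/-! ### Product generators (the ring structure of `𝒫^eff`) -/

/-- **Product generator** `a ⊠ b` in disjoint variables: `(a ⊠ b)(z, w) = a(z) · b(w)` on the
polydisc of radius `min ρ_a ρ_b`; the first `n` coordinates feed `a`, the last `m` feed `b`
(the convention of `KZ.IntegralRep.prod`). [Ayoub 2014, §2.2] -/
def soloInformedGenProd {n m : ℕ} (a : SoloInformedAyoubGen n) (b : SoloInformedAyoubGen m) :
    SoloInformedAyoubGen (n + m) where
  f z := a.f (fun i => z (Fin.castAdd m i)) * b.f (fun j => z (Fin.natAdd n j))
  ρ := min a.ρ b.ρ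
  one_lt := lt_min a.one_lt b.one_lt
  analytic :=
    (a.analytic.comp ((soloInformed_analyticOnNhd_proj (Fin.castAdd m)).mono (subset_univ _))
        (fun _ hz => soloInformed_proj_mem_ball (Fin.castAdd m) hz (min_le_left _ _))).mul
      (b.analytic.comp ((soloInformed_analyticOnNhd_proj (Fin.natAdd n)).mono (subset_univ _))
        (fun _ hz => soloInformed_proj_mem_ball (Fin.natAdd n) hz (min_le_right _ _)))
  real x hx := by
    have ha := a.real (fun i => x (Fin.castAdd m i)) (by
      rw [← soloInformedToC_proj]
      exact soloInformed_proj_mem_ball (Fin.castAdd m) hx (min_le_left _ _))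
    have hb := b.real (fun j => x (Fin.natAdd n j)) (by
      rw [← soloInformedToC_proj]
      exact soloInformed_proj_mem_ball (Fin.natAdd n) hx (min_le_right _ _))
    rw [← soloInformedToC_proj] at ha hb
    change (a.f (fun i => soloInformedToC (n + m) x (Fin.castAdd m i)) *
      b.f (fun j => soloInformedToC (n + m) x (Fin.natAdd n j))).im = 0
    rw [Complex.mul_im, ha, hb, mul_zero, zero_mul, add_zero]
  algebraic :=
    soloInformed_mul_mem_algFns
      (soloInformed_algFns_mono
        (fun _ hz => soloInformed_proj_mem_ball (Fin.castAdd m) hz (min_le_left _ _))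
        (soloInformed_algFns_comp_proj (e := Fin.castAdd m) (Fin.castAdd_injective n m)
          a.algebraic))
      (soloInformed_algFns_mono
        (fun _ hz => soloInformed_proj_mem_ball (Fin.natAdd n) hz (min_le_right _ _))
        (soloInformed_algFns_comp_proj (e := Fin.natAdd n) (Fin.natAdd_injective m n)
          b.algebraic))

/-- Unfolding the product generator. -/
@[simp] theorem soloInformedGenProd_f {n m : ℕ} (a : SoloInformedAyoubGen n)
    (b : SoloInformedAyoubGen m) (z : Fin (n + m) → ℂ) :
    (soloInformedGenProd a b).f z =
      a.f (fun i => z (Fin.castAdd m i)) * b.f (fun j => z (Fin.natAdd n j)) := rfl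

/-- **`Ψ` is multiplicative on product generators, modulo the KZ moves**:
`⟦Ψ[a ⊠ b]⟧ = ⟦Ψ[a]⟧ · ⟦Ψ[b]⟧` in the formal period ring. The two sides are the representations
`[[0,1]ⁿ⁺ᵐ, Re (a ⊠ b)]` and `[[0,1]ⁿ × [0,1]ᵐ, Re a ⊗ Re b]` (by `KZ.of_mul_of`), with equal
domains and integrands agreeing on the domain (realness of `a`, `b` on the cube).
[Kontsevich–Zagier 2001, §4.1; Ayoub 2014, §2.2] -/
theorem soloInformed_toFormalPeriod_psi_genProd (hQ : SoloInformedAyoubLemmaQ) {n m : ℕ}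
    (a : SoloInformedAyoubGen n) (b : SoloInformedAyoubGen m) :
    toFormalPeriod (soloInformedAyoubPsi hQ (soloInformedAyoubOf (soloInformedGenProd a b))) =
      toFormalPeriod (soloInformedAyoubPsi hQ (soloInformedAyoubOf a)) *
        toFormalPeriod (soloInformedAyoubPsi hQ (soloInformedAyoubOf b)) := by
  rw [soloInformedAyoubPsi_of, soloInformedAyoubPsi_of, soloInformedAyoubPsi_of,
    toFormalPeriod_of_mul_of, toFormalPeriod_eq_iff]
  refine of_sub_of_mem_relations_of_eqOn ?_ ?_
  · ext z
    simp only [IntegralRep.prod_domain, IntegralRep.mem_prodDomain, soloInformedAyoubPsiRep_domain,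
      soloInformed_mem_cube_iff]
    constructor
    · rintro ⟨h₁, h₂⟩ l
      induction l using Fin.addCases with
      | left i => exact h₁ i
      | right j => exact h₂ j
    · intro h
      exact ⟨fun i => h _, fun j => h _⟩
  · intro z hz
    rw [soloInformedAyoubPsiRep_domain, soloInformed_mem_cube_iff] at hz
    have hza : (fun i => z (Fin.castAdd m i)) ∈ soloInformedCube n := fun i => hz _
    have hzb : (fun j => z (Fin.natAdd n j)) ∈ soloInformedCube m := fun j => hz _
    have ha := soloInformedAyoub_real_cube hQ a _ hza
    have hb := soloInformedAyoub_real_cube hQ b _ hzb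
    rw [IntegralRep.prod_integrand_eq, IntegralRep.prodFun_apply, soloInformedAyoubPsiRep_integrand,
      soloInformedAyoubPsiRep_integrand, soloInformedAyoubPsiRep_integrand]
    simp only [soloInformedGenProd_f]
    rw [soloInformedToC_proj (Fin.castAdd m), soloInformedToC_proj (Fin.natAdd n), Complex.mul_re,
      ha, hb, mul_zero, sub_zero]

/-! ### Complex symbols as pairs, and multiplication by a complex generator -/

/-- Right multiplication by a one-variable generator on symbols: `[a] ↦ [a ⊠ g]`. -/
def soloInformedMulGen (g : SoloInformedAyoubGen 1) :
    SoloInformedAyoubSymbols →+ SoloInformedAyoubSymbols :=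
  FreeAbelianGroup.lift fun a => soloInformedAyoubOf (soloInformedGenProd a.2 g)

/-- `(· ⊠ g)` on a generator. -/
@[simp] theorem soloInformedMulGen_of (g : SoloInformedAyoubGen 1) {n : ℕ}
    (a : SoloInformedAyoubGen n) :
    soloInformedMulGen g (soloInformedAyoubOf a) = soloInformedAyoubOf (soloInformedGenProd a g) :=
  FreeAbelianGroup.lift_apply_of _ _

/-- **Multiplication by the complex generator `θ = g + i·h`** on complex symbols, represented as
pairs `(u, v)` ("`u + i·v`") of real symbols: `θ·(u + iv) = (u⊠g − v⊠h) + i (u⊠h + v⊠g)`.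
[Ayoub 2014, §2.2, Def. 10] -/
def soloInformedMulTheta (g h : SoloInformedAyoubGen 1)
    (p : SoloInformedAyoubSymbols × SoloInformedAyoubSymbols) :
    SoloInformedAyoubSymbols × SoloInformedAyoubSymbols :=
  (soloInformedMulGen g p.1 - soloInformedMulGen h p.2,
    soloInformedMulGen h p.1 + soloInformedMulGen g p.2)

/-- **Ayoub's conjecture, localised and typed on Ayoub's side** [Ayoub 2014, Def. 10, Prop. 11,
Rem. 13]: there is a complex one-variable generator `θ = g + i h` with `Ev θ = 2πi` such that every
REAL symbol `x` with `Ev x = 0` dies in `(Symbols ⧸ Rel) ⊗ ℤ[i] [θ⁻¹] ⊗ ℚ`, i.e.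
`θ^N · (k x) ∈ Rel ⊕ i·Rel` for some `N` and some `k ≠ 0`. Ayoub's `𝒫 := 𝒫^eff[θ⁻¹]`
(Def. 10) and "`Ev : 𝒫 → ℂ` is injective ⟸ Grothendieck's period conjecture for all Nori motives"
(Prop. 11 with [Huber–Müller-Stach 2017, Prop. 13.2.6]); the restriction to real symbols and the
factor `k` (`⊗ ℚ`) only weaken the statement. OPEN; used only as an explicit hypothesis.
[cite: Ayoub2014, Def. 10, Prop. 11, Rem. 13] -/
@[conjecture] def SoloInformedAyoubEvInjLoc : Prop :=
  ∃ g h : SoloInformedAyoubGen 1,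
    soloInformedAyoubEv (soloInformedAyoubOf g) +
        soloInformedAyoubEv (soloInformedAyoubOf h) * Complex.I = 2 * Real.pi * Complex.I ∧
      ∀ x : SoloInformedAyoubSymbols, soloInformedAyoubEv x = 0 →
        ∃ N k : ℕ, k ≠ 0 ∧
          ((soloInformedMulTheta g h)^[N] (k • x, 0)).1 ∈ soloInformedAyoubRel ∧
          ((soloInformedMulTheta g h)^[N] (k • x, 0)).2 ∈ soloInformedAyoubRel

/-! ### The push-forward `Ψ ⊗ ℤ[i]` -/

/-- `⟦Ψ (x ⊠ g)⟧ = ⟦Ψ x⟧ · ⟦Ψ[g]⟧` for every symbol `x`. -/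
theorem soloInformed_toFormalPeriod_psi_mulGen (hQ : SoloInformedAyoubLemmaQ)
    (g : SoloInformedAyoubGen 1) (x : SoloInformedAyoubSymbols) :
    toFormalPeriod (soloInformedAyoubPsi hQ (soloInformedMulGen g x)) =
      toFormalPeriod (soloInformedAyoubPsi hQ x) *
        toFormalPeriod (soloInformedAyoubPsi hQ (soloInformedAyoubOf g)) := by
  induction x using FreeAbelianGroup.induction_on with
  | zero => simp
  | of a =>
    obtain ⟨n, a⟩ := a
    change toFormalPeriod (soloInformedAyoubPsi hQ (soloInformedMulGen g (soloInformedAyoubOf a))) =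
      toFormalPeriod (soloInformedAyoubPsi hQ (soloInformedAyoubOf a)) * _
    rw [soloInformedMulGen_of, soloInformed_toFormalPeriod_psi_genProd]
  | neg x ih => rw [map_neg, map_neg, map_neg, ih, map_neg, map_neg, neg_mul]
  | add x y hx hy => rw [map_add, map_add, map_add, hx, hy, map_add, map_add, add_mul]

/-- Bookkeeping of `θ^N = A_N + i B_N` in `P ⊗ ℤ[i]`: `(A_0, B_0) = (1, 0)`,
`(A_{N+1}, B_{N+1}) = (A_N G − B_N H, A_N H + B_N G)`. -/
def soloInformedCPow (G H : FormalPeriodRing) : ℕ → FormalPeriodRing × FormalPeriodRing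
  | 0 => (1, 0)
  | N + 1 => ((soloInformedCPow G H N).1 * G - (soloInformedCPow G H N).2 * H,
      (soloInformedCPow G H N).1 * H + (soloInformedCPow G H N).2 * G)

/-- **`Ψ ⊗ ℤ[i]` intertwines multiplication by `θ`**: writing `θ^N = A_N + i B_N` with
`G = ⟦Ψ[g]⟧`, `H = ⟦Ψ[h]⟧`, the pair `θ^N (u, v)` maps to
`(⟦Ψu⟧ A_N − ⟦Ψv⟧ B_N, ⟦Ψu⟧ B_N + ⟦Ψv⟧ A_N)`. -/
theorem soloInformed_toFormalPeriod_psi_mulTheta_iterate (hQ : SoloInformedAyoubLemmaQ)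
    (g h : SoloInformedAyoubGen 1) (N : ℕ)
    (p : SoloInformedAyoubSymbols × SoloInformedAyoubSymbols) :
    toFormalPeriod (soloInformedAyoubPsi hQ ((soloInformedMulTheta g h)^[N] p).1) =
        toFormalPeriod (soloInformedAyoubPsi hQ p.1) *
            (soloInformedCPow (toFormalPeriod (soloInformedAyoubPsi hQ (soloInformedAyoubOf g)))
              (toFormalPeriod (soloInformedAyoubPsi hQ (soloInformedAyoubOf h))) N).1 -
          toFormalPeriod (soloInformedAyoubPsi hQ p.2) *
            (soloInformedCPow (toFormalPeriod (soloInformedAyoubPsi hQ (soloInformedAyoubOf g)))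
              (toFormalPeriod (soloInformedAyoubPsi hQ (soloInformedAyoubOf h))) N).2 ∧
      toFormalPeriod (soloInformedAyoubPsi hQ ((soloInformedMulTheta g h)^[N] p).2) =
        toFormalPeriod (soloInformedAyoubPsi hQ p.1) *
            (soloInformedCPow (toFormalPeriod (soloInformedAyoubPsi hQ (soloInformedAyoubOf g)))
              (toFormalPeriod (soloInformedAyoubPsi hQ (soloInformedAyoubOf h))) N).2 +
          toFormalPeriod (soloInformedAyoubPsi hQ p.2) *
            (soloInformedCPow (toFormalPeriod (soloInformedAyoubPsi hQ (soloInformedAyoubOf g)))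
              (toFormalPeriod (soloInformedAyoubPsi hQ (soloInformedAyoubOf h))) N).1 := by
  induction N with
  | zero => simp [soloInformedCPow]
  | succ N ih =>
    obtain ⟨ih₁, ih₂⟩ := ih
    rw [Function.iterate_succ_apply']
    simp only [soloInformedMulTheta, soloInformedCPow, map_sub, map_add,
      soloInformed_toFormalPeriod_psi_mulGen, ih₁, ih₂]
    constructor <;> ring

/-- `evalP ⊗ ℂ` of the bookkeeping pair: `evalP A_N + i evalP B_N = (evalP G + i evalP H)^N`. -/
theorem soloInformed_evalP_cpow (G H : FormalPeriodRing) (N : ℕ) :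
    ((evalP (soloInformedCPow G H N).1 : ℝ) : ℂ) +
        ((evalP (soloInformedCPow G H N).2 : ℝ) : ℂ) * Complex.I =
      (((evalP G : ℝ) : ℂ) + ((evalP H : ℝ) : ℂ) * Complex.I) ^ N := by
  induction N with
  | zero => simp [soloInformedCPow]
  | succ N ih =>
    rw [pow_succ, ← ih]
    apply Complex.ext <;> simp [soloInformedCPow]

/-- The evaluation of a generator is real: `Ev[a] = Re Ev[a]`. -/
theorem soloInformedAyoubEv_of_eq_re (hQ : SoloInformedAyoubLemmaQ) {n : ℕ}
    (a : SoloInformedAyoubGen n) :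
    soloInformedAyoubEv (soloInformedAyoubOf a) =
      ((soloInformedAyoubEv (soloInformedAyoubOf a)).re : ℂ) := by
  apply Complex.ext
  · simp
  · rw [Complex.ofReal_im]
    exact soloInformedAyoubEv_of_im_eq_zero a (soloInformedAyoub_continuousOn_cube hQ a)
      (soloInformedAyoub_real_cube hQ a)

/-- `evalP ⟦Ψ[a]⟧ = Ev[a]` (as complex numbers) for a generator `a`. -/
theorem soloInformed_evalP_toFormalPeriod_psi_of (hQ : SoloInformedAyoubLemmaQ) {n : ℕ}
    (a : SoloInformedAyoubGen n) :
    ((evalP (toFormalPeriod (soloInformedAyoubPsi hQ (soloInformedAyoubOf a))) : ℝ) : ℂ) =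
      soloInformedAyoubEv (soloInformedAyoubOf a) := by
  rw [evalP_toFormalPeriod, soloInformed_eval_psi, ← soloInformedAyoubEv_of_eq_re hQ a]

/-! ### The theorem -/

/-- **Ayoub's localised injectivity (typed on Ayoub's side) implies its KZ-side reading.**
Push `θ^N (k x) ∈ Rel ⊕ i Rel` forward by `Ψ ⊗ ℤ[i]`: `k ⟦Ψx⟧ A_N = 0 = k ⟦Ψx⟧ B_N` in `P`
with `evalP A_N + i evalP B_N = (2πi)^N ≠ 0`; cancel `k` (FACT M: `P` is torsion-free) and lift a
component of non-zero period to `u : FormalRep`. [Ayoub 2014, Rem. 13; KZ 2001, §4.1] -/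
theorem soloInformed_ayoubKZLoc_of_evInjLoc (hI : SoloInformedAyoubEvInjLoc) :
    SoloInformedAyoubKZLoc := by
  obtain ⟨g, h, hθ, hinj⟩ := hI
  intro x hx
  obtain ⟨N, k, hk, h₁, h₂⟩ := hinj x hx
  haveI := soloInformed_noZeroSMulDivisors_nat
  set Ψ := soloInformedAyoubPsi soloInformed_ayoubLemmaQ with hΨ
  set G := toFormalPeriod (Ψ (soloInformedAyoubOf g)) with hG
  set H := toFormalPeriod (Ψ (soloInformedAyoubOf h)) with hH
  set X := toFormalPeriod (Ψ x) with hX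
  obtain ⟨hit₁, hit₂⟩ :=
    soloInformed_toFormalPeriod_psi_mulTheta_iterate soloInformed_ayoubLemmaQ g h N (k • x, 0)
  rw [← hΨ, ← hG, ← hH] at hit₁ hit₂
  simp only [map_zero, zero_mul, sub_zero, add_zero, map_nsmul] at hit₁ hit₂
  rw [toFormalPeriod_eq_zero_iff.2 (soloInformedAyoubPsi_rel _ h₁), ← hX, smul_mul_assoc,
    eq_comm, smul_eq_zero] at hit₁
  rw [toFormalPeriod_eq_zero_iff.2 (soloInformedAyoubPsi_rel _ h₂), ← hX, smul_mul_assoc,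
    eq_comm, smul_eq_zero] at hit₂
  have hA : X * (soloInformedCPow G H N).1 = 0 := hit₁.resolve_left hk
  have hB : X * (soloInformedCPow G H N).2 = 0 := hit₂.resolve_left hk
  -- one of `A_N`, `B_N` has non-zero period
  have hev := soloInformed_evalP_cpow G H N
  rw [hG, hH, soloInformed_evalP_toFormalPeriod_psi_of, soloInformed_evalP_toFormalPeriod_psi_of,
    hθ] at hev
  have hne : ((evalP (soloInformedCPow G H N).1 : ℝ) : ℂ) +
      ((evalP (soloInformedCPow G H N).2 : ℝ) : ℂ) * Complex.I ≠ 0 := by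
    rw [hev]
    exact pow_ne_zero _ (mul_ne_zero (mul_ne_zero two_ne_zero
      (Complex.ofReal_ne_zero.2 Real.pi_ne_zero)) Complex.I_ne_zero)
  -- lift a component of non-zero period
  have key : ∀ C : FormalPeriodRing, evalP C ≠ 0 → X * C = 0 →
      ∃ u : FormalRep, eval u ≠ 0 ∧ u * Ψ x ∈ relations := by
    intro C hC hXC
    obtain ⟨u, rfl⟩ := toFormalPeriod_surjective C
    refine ⟨u, hC, ?_⟩
    rw [← toFormalPeriod_eq_zero_iff, map_mul, mul_comm, ← hX]
    exact hXC
  by_cases hA0 : evalP (soloInformedCPow G H N).1 = 0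
  · refine key _ (fun hB0 => hne ?_) hB
    rw [hA0, hB0]
    simp
  · exact key _ hA0 hA

/-- **Transfer chain with the typed hypothesis**: separation of poles, semialgebraic Nash
cubulation, Ayoub's localised injectivity (typed on Ayoub's side) and saturation of the formal
period ring imply the Kontsevich–Zagier period conjecture.
[Ayoub 2014, Prop. 11, Rem. 13; Kontsevich–Zagier 2001, §1.2, §4.1] -/
theorem soloInformed_ayoubTransferInj₈ (H₂ : SoloInformedSeparationOfPoles)
    (hN : SoloInformedNashCubulation) (hI : SoloInformedAyoubEvInjLoc) (hS : SoloInformedKZSat) :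
    KontsevichZagierPeriods :=
  soloInformed_ayoubTransferLoc₈ H₂ hN (soloInformed_ayoubKZLoc_of_evInjLoc hI) hS

/-- The same with integrality of the formal period ring in place of saturation. -/
theorem soloInformed_ayoubTransferInjDom₈ (H₂ : SoloInformedSeparationOfPoles)
    (hN : SoloInformedNashCubulation) (hI : SoloInformedAyoubEvInjLoc)
    (hD : SoloInformedKZDomain) : KontsevichZagierPeriods :=
  soloInformed_ayoubTransferInj₈ H₂ hN hI (soloInformed_kzSat_of_kzDomain hD)

end Summit.KontsevichZagierPeriods.KontsevichZagierPeriods.Theorems
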